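import Mathlib.NumberTheory.Padics.PadicNumbers
import Literature.NumberTheory.EllipticCurves.TwoAdicImageGoodOrdinaryAtTwoProofs
import Literature.NumberTheory.EllipticCurves.QuadraticTwistAtTwoMinimalModelProofs
import Summits.BirchSwinnertonDyer.BirchSwinnertonDyer.Theorems.EisensteinDepletionAtTwoStarGlueFinScaleLemmas
import HarnessLib

/-!
# The unit-root / Katz–Koblitz kernel at a good ORDINARY prime `2` (helper; MEMO-an §57, cell `bsd-f1-sign2`, seat `-an` g53/g54)

Crux `stmt-BirchSwinnertonDyer-23715` (`Theses.ByReductionTypeAtTwo.RankOneAtTwoBigImageOddLocal`), ordinary branch; helper file —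
closes nothing, asserts nothing new (D-0182 finish-and-book of the §57 kernel announced by -an g53, whose typed candidate `Prop`s
`UnitRootParityLawAtTwo`, `UnitRootTraceLawAtTwo`, `E2CongruenceC6C4AtTwo(Exact)`, `KoblitzKatzTruncationAtTwo k` stay in the crux
workfile `Cruxes/RankOneAtTwoBigImageOddLocal/UnitRootClosedFormAN61.lean`; nothing of them is asserted here).

CONTENT (all proved, no `sorry`, Props unfolded — no `def`; `‖odd‖₂ = 1` is the landed `DepletionAtTwo.norm_intCast_eq_one_of_odd`):
* `norm_c₄_baseChange_two_eq_one`, `norm_c₆_baseChange_two_eq_one`, `norm_Δ_baseChange_two_eq_one`,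
  `norm_c₄_c₆_Δ_eq_one_of_good_ordinary_two` / `…_of_goodOrd_two` — on a globally minimal model with good ORDINARY reduction at `2`
  (`2 ∤ a₂(W)`), the invariants `c₄`, `c₆`, `Δ` of `W ⊗ ℚ₂` are `2`-adic units: ordinary ⟹ `a₁` odd (tree:
  `odd_a₁_of_hasGoodReductionAtPrime_two_of_odd_frobeniusTrace_two`) ⟹ `c₄` odd (tree: `WeierstrassCurve.odd_c₄_int_of_odd_a₁`) and
  `c₆ ≡ −1 (mod 4)` (tree: `exists_c₆_eq_of_odd_a₁`); good at `2` ⟹ `Δ_min` odd (tree: `odd_Δ_integralModelInt_of_good_two`).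
  [cite: SilvermanAEC2009, Exercise 8.15 (a), VII.5 Prop. 5.1(a)]
* `norm_eq_of_truncation_one` — the ultrametric step: `‖c₄³·A + 720·c₆·Δ‖₂ ≤ 2⁻⁵` with `c₄, c₆, Δ` units forces `‖A‖₂ = 2⁻⁴`
  (`‖720‖₂ = 2⁻⁴`). [folklore]
* `norm_e2_mul_c₄_add_c₆_eq_of_truncation_one` — curve level, for ANY `E : ℚ₂` (intended: the value `E₂(W, ω)` of Katz's `2`-adic
  weight-2 Eisenstein series, `= b₂ − 12·c` for a Mazur–Tate σ²-constant `c`): the `K = 2` truncation bound of the Koblitz–Katz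
  `1/j`-series, `‖E·c₄⁴ + c₆·(c₄³ + 720·Δ)‖₂ ≤ 2⁻⁵`, pins the EXACT valuation `v₂(E·c₄ + c₆) = 4` — i.e. the workfile's kernel
  `KoblitzKatzTruncationAtTwo 1 → E2CongruenceC6C4AtTwoExact` with both Props unfolded and the (irrelevant) Mazur–Tate pair binder dropped.
  [folklore]
BSD is not proved by any of this; 23715 is not closed.
-/

namespace Summit.BirchSwinnertonDyer.BirchSwinnertonDyer.Theorems.UnitRootKernelAtTwo

set_option linter.dupNamespace false

open WeierstrassCurve Literature.NumberTheory.EllipticCurves Literature.NumberTheory.EllipticCurves.Rank1Residual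
open Summit.BirchSwinnertonDyer.BirchSwinnertonDyer.Theorems.DepletionAtTwo (norm_intCast_eq_one_of_odd)

/-- `c₄(W ⊗ ℚ₂) = c₄` of the minimal integral equation. [folklore] -/
theorem c₄_baseChange_two_eq (W : WeierstrassCurve ℚ) [W.IsGloballyMinimal] :
    (W.baseChange ℚ_[2]).c₄ = ((integralModelInt W).c₄ : ℚ_[2]) := by
  have h := (integralModelInt W).map_c₄ (Int.castRingHom ℚ)
  rw [map_integralModelInt, eq_intCast] at h
  rw [baseChange, map_c₄, eq_ratCast, h, Rat.cast_intCast]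

/-- `c₆(W ⊗ ℚ₂) = c₆` of the minimal integral equation. [folklore] -/
theorem c₆_baseChange_two_eq (W : WeierstrassCurve ℚ) [W.IsGloballyMinimal] :
    (W.baseChange ℚ_[2]).c₆ = ((integralModelInt W).c₆ : ℚ_[2]) := by
  have h := (integralModelInt W).map_c₆ (Int.castRingHom ℚ)
  rw [map_integralModelInt, eq_intCast] at h
  rw [baseChange, map_c₆, eq_ratCast, h, Rat.cast_intCast]

/-- `Δ(W ⊗ ℚ₂) = Δ` of the minimal integral equation (the minimal discriminant). [folklore] -/
theorem Δ_baseChange_two_eq (W : WeierstrassCurve ℚ) [W.IsGloballyMinimal] :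
    (W.baseChange ℚ_[2]).Δ = ((integralModelInt W).Δ : ℚ_[2]) := by
  have h := (integralModelInt W).map_Δ (Int.castRingHom ℚ)
  rw [map_integralModelInt, eq_intCast] at h
  rw [baseChange, map_Δ, eq_ratCast, h, Rat.cast_intCast]

/-- `a₁` of the minimal equation odd ⟹ `c₄(W ⊗ ℚ₂)` is a `2`-adic unit. [cite: SilvermanAEC2009, Exercise 8.15 (a)] -/
theorem norm_c₄_baseChange_two_eq_one (W : WeierstrassCurve ℚ) [W.IsGloballyMinimal] (h : Odd (integralModelInt W).a₁) :
    ‖(W.baseChange ℚ_[2]).c₄‖ = 1 := by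
  rw [c₄_baseChange_two_eq]
  exact norm_intCast_eq_one_of_odd ((integralModelInt W).odd_c₄_int_of_odd_a₁ h)

/-- `a₁` of the minimal equation odd ⟹ `c₆(W ⊗ ℚ₂)` is a `2`-adic unit (`c₆ ≡ −1 (mod 4)`). [cite: SilvermanAEC2009, Exercise 8.15 (a)] -/
theorem norm_c₆_baseChange_two_eq_one (W : WeierstrassCurve ℚ) [W.IsGloballyMinimal] (h : Odd (integralModelInt W).a₁) :
    ‖(W.baseChange ℚ_[2]).c₆‖ = 1 := by
  rw [c₆_baseChange_two_eq]
  obtain ⟨m, hm⟩ := exists_c₆_eq_of_odd_a₁ (integralModelInt W) h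
  exact norm_intCast_eq_one_of_odd ⟨2 * m - 1, by rw [hm]; ring⟩

/-- Good reduction at `2` ⟹ `Δ(W ⊗ ℚ₂)` is a `2`-adic unit. [cite: SilvermanAEC2009, VII.5 Prop. 5.1(a)] -/
theorem norm_Δ_baseChange_two_eq_one (W : WeierstrassCurve ℚ) [W.IsElliptic] [W.IsGloballyMinimal]
    (hgood : W.HasGoodReductionAtPrime 2) : ‖(W.baseChange ℚ_[2]).Δ‖ = 1 := by
  rw [Δ_baseChange_two_eq]
  exact norm_intCast_eq_one_of_odd (odd_Δ_integralModelInt_of_good_two W hgood)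

/-- **Good ORDINARY reduction at `2` ⟹ `c₄`, `c₆`, `Δ` of `W ⊗ ℚ₂` are `2`-adic units** (= the workfile's bookkeeping target
`UnitInvariantsAtTwo`, unfolded). [cite: SilvermanAEC2009, Exercise 8.15 (a), VII.5 Prop. 5.1(a)] -/
theorem norm_c₄_c₆_Δ_eq_one_of_good_ordinary_two (W : WeierstrassCurve ℚ) [W.IsElliptic] [W.IsGloballyMinimal]
    (hgood : W.HasGoodReductionAtPrime 2) (hord : ¬ (2 : ℤ) ∣ W.frobeniusTrace 2) :
    ‖(W.baseChange ℚ_[2]).c₄‖ = 1 ∧ ‖(W.baseChange ℚ_[2]).c₆‖ = 1 ∧ ‖(W.baseChange ℚ_[2]).Δ‖ = 1 := by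
  have hodd : Odd (W.frobeniusTrace 2) := by
    rcases Int.even_or_odd (W.frobeniusTrace 2) with he | ho
    · exact absurd (even_iff_two_dvd.mp he) hord
    · exact ho
  have ha₁ : Odd (integralModelInt W).a₁ := odd_a₁_of_hasGoodReductionAtPrime_two_of_odd_frobeniusTrace_two W hgood hodd
  exact ⟨norm_c₄_baseChange_two_eq_one W ha₁, norm_c₆_baseChange_two_eq_one W ha₁, norm_Δ_baseChange_two_eq_one W hgood⟩

/-- The same, over the tree's `GoodOrd W 2` binder. [cite: SilvermanAEC2009, Exercise 8.15 (a), VII.5 Prop. 5.1(a)] -/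
theorem norm_c₄_c₆_Δ_eq_one_of_goodOrd_two (W : WeierstrassCurve ℚ) [W.IsElliptic] [W.IsGloballyMinimal] (h : GoodOrd W 2) :
    ‖(W.baseChange ℚ_[2]).c₄‖ = 1 ∧ ‖(W.baseChange ℚ_[2]).c₆‖ = 1 ∧ ‖(W.baseChange ℚ_[2]).Δ‖ = 1 :=
  norm_c₄_c₆_Δ_eq_one_of_good_ordinary_two W h.1 h.2

/-- `‖720‖₂ = 2⁻⁴` (`720 = 2⁴·45`). [folklore] -/
theorem norm_seven_twenty : ‖(720 : ℚ_[2])‖ = 2⁻¹ ^ 4 := by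
  have h45 : ‖((45 : ℤ) : ℚ_[2])‖ = 1 := norm_intCast_eq_one_of_odd ⟨22, by norm_num⟩
  have h16 : ‖((2 : ℕ) : ℚ_[2]) ^ 4‖ = 2⁻¹ ^ 4 := by
    rw [Padic.norm_p_pow]; norm_num
  have : (720 : ℚ_[2]) = ((2 : ℕ) : ℚ_[2]) ^ 4 * ((45 : ℤ) : ℚ_[2]) := by push_cast; norm_num
  rw [this, norm_mul, h16, h45, mul_one]

/-- The ultrametric step: `‖c₄³·A + 720·c₆·Δ‖₂ ≤ 2⁻⁵` with `c₄, c₆, Δ` units forces `‖A‖₂ = 2⁻⁴`. [folklore] -/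
theorem norm_eq_of_truncation_one {A c4 c6 D : ℚ_[2]} (h4 : ‖c4‖ = 1) (h6 : ‖c6‖ = 1) (hD : ‖D‖ = 1)
    (h : ‖c4 ^ 3 * A + 720 * c6 * D‖ ≤ 2⁻¹ ^ 5) : ‖A‖ = 2⁻¹ ^ 4 := by
  have hT : ‖(720 : ℚ_[2]) * c6 * D‖ = 2⁻¹ ^ 4 := by
    rw [norm_mul, norm_mul, norm_seven_twenty, h6, hD]; ring
  have hS : ‖c4 ^ 3 * A + 720 * c6 * D‖ < ‖-(720 * c6 * D)‖ := by
    rw [norm_neg, hT]; exact lt_of_le_of_lt h (by norm_num)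
  have key : ‖(c4 ^ 3 * A + 720 * c6 * D) + -(720 * c6 * D)‖ =
      max ‖c4 ^ 3 * A + 720 * c6 * D‖ ‖-(720 * c6 * D)‖ := Padic.add_eq_max_of_ne (ne_of_lt hS)
  have hsimp : (c4 ^ 3 * A + 720 * c6 * D) + -(720 * c6 * D) = c4 ^ 3 * A := by ring
  rw [hsimp, max_eq_right (le_of_lt hS), norm_neg, hT, norm_mul, norm_pow, h4, one_pow, one_mul] at key
  exact key

/-- **KERNEL (curve level, unconditional in the invariants).** On a globally minimal model with good ORDINARY reduction at `2`,
for any `E : ℚ₂`, the `K = 2` Koblitz–Katz truncation bound `‖E·c₄⁴ + c₆·(c₄³ + 720·Δ)‖₂ ≤ 2⁻⁵` forces the EXACT valuation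
`‖E·c₄ + c₆‖₂ = 2⁻⁴` (workfile: `KoblitzKatzTruncationAtTwo 1 → E2CongruenceC6C4AtTwoExact`, unfolded). [folklore] -/
theorem norm_e2_mul_c₄_add_c₆_eq_of_truncation_one (W : WeierstrassCurve ℚ) [W.IsElliptic] [W.IsGloballyMinimal]
    (hgood : W.HasGoodReductionAtPrime 2) (hord : ¬ (2 : ℤ) ∣ W.frobeniusTrace 2) (E : ℚ_[2])
    (h : ‖E * (W.baseChange ℚ_[2]).c₄ ^ 4 +
        (W.baseChange ℚ_[2]).c₆ * ((W.baseChange ℚ_[2]).c₄ ^ 3 + 720 * (W.baseChange ℚ_[2]).Δ)‖ ≤ 2⁻¹ ^ 5) :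
    ‖E * (W.baseChange ℚ_[2]).c₄ + (W.baseChange ℚ_[2]).c₆‖ = 2⁻¹ ^ 4 := by
  obtain ⟨h4, h6, hD⟩ := norm_c₄_c₆_Δ_eq_one_of_good_ordinary_two W hgood hord
  refine norm_eq_of_truncation_one h4 h6 hD ?_
  have hre : (W.baseChange ℚ_[2]).c₄ ^ 3 * (E * (W.baseChange ℚ_[2]).c₄ + (W.baseChange ℚ_[2]).c₆)
        + 720 * (W.baseChange ℚ_[2]).c₆ * (W.baseChange ℚ_[2]).Δ
      = E * (W.baseChange ℚ_[2]).c₄ ^ 4 +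
        (W.baseChange ℚ_[2]).c₆ * ((W.baseChange ℚ_[2]).c₄ ^ 3 + 720 * (W.baseChange ℚ_[2]).Δ) := by ring
  rw [hre]
  exact h

end Summit.BirchSwinnertonDyer.BirchSwinnertonDyer.Theorems.UnitRootKernelAtTwo
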